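import Literature.Probability.Percolation.TriMarkedDomainOfDartsStretch
import Literature.Probability.Percolation.TriMarkedRingLocal
import HarnessLib

/-!
# Attaching one hexagon: the boundary order, the marks of `ofDarts`, and the corner face of a turning mark («ATTACH-ORDER»)

Topic `Literature/Probability/Percolation`; family `crit-perc` / marked-loop lineage; a rider on `TriDiscShelling.lean` (`RemovableAt G u a m`: the outside neighbours of `u ∈ G`
are those at the `m` consecutive offsets `a, …, a + m − 1`; the boundary cycle of `G ∖ {u}` from `dPlus` is the old cycle with the block of darts out of `u` replaced by the new
darts into `u` — `iter_block`, `iter_erase_eq`), on `TriMarkedDomainOfDarts(Stretch).lean` (`ofDarts`: marking a discrete domain at a set of markable darts, numbered by visit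
time = `dpos` from the base) and on `MarkedLoopSpace.lean` (the corner face `yc D i` of the `i`-th mark).

The one-hexagon surgery identities of the boundary-law calculus (HOME `FINDING-BSPAN-SLIDE-INDUCTION.md` §4; the SLIDE identity `MarkedLoopLawSlide.SlideData`) compare marked
domains on `G' = G ∪ {h}` and on `G` INDEX BY INDEX: the `i`-th corner face of one must be the `i`-th corner face of the other, except at the slid mark. This file supplies the
three bookkeeping facts that make such instances constructible in any coordinate family (the sandpile class in particular):

* §1 `TriMarkedDomain.rebase₀` — an unmarked discrete domain traversed from any of its boundary darts (so that two domains can be numbered from a COMMON dart);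
* §2 ★ `MarkedLoops.yc_eq_leftFaceDir` — the corner face of a mark whose marked dart is `(g, g + e_{j+1})` with `g + e_j ∉ G` (the boundary walk TURNS about `g` there) is the
  face `leftFaceDir g j = {g, g + e_j, g + e_{j+1}}`; with `triBdrySucc_injOn` (`Set.InjOn` of the boundary successor on the boundary darts of a disc, any `k` — the `k = 3`
  instance is the lineage's `MarkedLoops.succ_injective`) and `predDart_eq_of_succ_eq`;
* §3 ★★ the BOUNDARY ORDER UNDER ATTACHMENT: for `D'` on `G'`, `D₁` on `G' ∖ {h}` (`RemovableAt G' h a m`) with the SAME base dart `b`, `b` an old dart other than `dPlus`: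
  `dpos_eq_of_iter_dPlus` (positions from a rebased dart), ★ `dpos_lt_dpos_iff_of_common` — two darts common to both boundaries compare identically in the two domains —, and
  ★ `dpos_lt_blk_iff` — a common dart precedes a block dart `(h, h + e_{a+t})` of `G'` iff it precedes `dPlus` in `G' ∖ {h}` (the block and `dPlus` occupy the same slot of the
  common cyclic order);
* §4 ★★ `ofDarts_markDart_eq_of_strictMono` — THE MARKS OF `ofDarts` ARE THE UNIQUE INCREASING ENUMERATION of the marked set: any `f : Fin k → S` strictly increasing in
  position is `markDart`; hence ★★ `ofDarts_markDart_eq_of_orderIso` — an order-preserving bijection between the marked sets of two `ofDarts` domains carries marks to marks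
  index by index.

## References
* B. Bollobás, O. Riordan, *Percolation*, CUP (2006), Ch. 7 §7.2.2 pp. 168–169 (the boundary cycle of a discrete domain traversed anticlockwise; marked sites in this order,
  marked at the second outside neighbour).
* M. Khristoforov, S. Smirnov, *Percolation and O(1) loop model*, arXiv:2111.15612 (2021), §1.2 (arXiv v1 p. 2: the marked points / corner disorders in cyclic order).

## Mathlib / tree
Mathlib: `Finset.orderEmbOfFin_unique`, `StrictMono`, `Nat.mod_eq_of_lt`. Tree: `TriDiscShelling` (`IsTriDisc`, `rebase`, `iter_eq_iter_iff`, `iter_add_card`, `eq_iter_pred`,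
`triBdryIter_add`, `RemovableAt.{blk, nw, dPlus, dMinus, iter_block, iter_dMinus, iter_fst_ne, iter_erase_eq, newIter, isTriDisc_dPlus, dPlus_mem, blk_mem, le_five, one_le}`,
`leftFaceDir`, `RemovableAt.hexFaceVertices_leftFaceDir`), `TriDiscInterface` (`dpos`, `dpos_lt`, `iter_dpos`, `dpos_eq_of_iter_eq`), `TriMarkedDomainOfDarts(Stretch)` (`ofDarts`,
`ofDarts_markDart`, `dartPos`, `visitTimes`, `exists_visitTime_eq_dartPos`, `visitTime_eq_dpos`, `card_visitTimes_of_markable`), `MarkedLoopSpace` (`yc`, `eq_yc`, `IsCornerFace`,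
`predDart`, `succ_predDart`, `predDart_mem`, `markDart_mem`, `markSite_mem`, `markDart_snd_not_mem`), `TriMarkedRingLocal` (`triBdrySucc_turn`).
-/

noncomputable section

open Finset Literature.Probability.LatticeModels

namespace Literature.Probability.Percolation

namespace TriMarkedDomain

/-! ## §1 Rebasing an unmarked domain -/

/-- **an unmarked discrete domain traversed from any boundary dart** (same sites; `IsTriDisc.rebase`). [cite: BollobasRiordan2006, Ch. 7 §7.2.2 p. 168 (the boundary is one cycle)] -/
def rebase₀ (D : TriMarkedDomain 0) {d : Site 2 × Site 2} (hd : d ∈ triBdryDarts D.verts) : TriMarkedDomain 0 where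
  verts := D.verts
  base := d
  pos := Fin.elim0
  base_mem := hd
  connected := D.connected
  outer_connected := D.outer_connected
  no_cut := D.no_cut
  outer_no_cut := D.outer_no_cut
  euler := D.euler
  cycle := (D.isTriDisc.rebase hd).cycle
  cycle_len := (D.isTriDisc.rebase hd).cycle_len
  pos_zero := fun h => absurd h (lt_irrefl 0)
  pos_strictMono := fun i => Fin.elim0 i
  pos_lt := fun i => Fin.elim0 i
  mark_pred := fun i => Fin.elim0 i
  mark_pred_pred := fun i => Fin.elim0 i
  mark_injective := fun i => Fin.elim0 i

/-- its sites. [cite: BollobasRiordan2006, Ch. 7 §7.2.2 p. 168; lane plumbing] -/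
@[simp] theorem rebase₀_verts (D : TriMarkedDomain 0) {d : Site 2 × Site 2} (hd : d ∈ triBdryDarts D.verts) : (D.rebase₀ hd).verts = D.verts := rfl

/-- its base. [cite: BollobasRiordan2006, Ch. 7 §7.2.2 p. 168; lane plumbing] -/
@[simp] theorem rebase₀_base (D : TriMarkedDomain 0) {d : Site 2 × Site 2} (hd : d ∈ triBdryDarts D.verts) : (D.rebase₀ hd).base = d := rfl

/-! ## §2 The boundary successor is injective; the corner face of a turning mark -/

variable {k : ℕ} (D : TriMarkedDomain k)

/-- ★ **the boundary successor is injective on the boundary darts of a discrete domain, any number of marks** (the boundary is ONE cycle; the `k = 3` instance is the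
lineage's `MarkedLoops.succ_injective` in `KhSThreeDisorderCrossing`, stated there under `variable (D : TriMarkedDomain 3)` only). [cite: BollobasRiordan2006, Ch. 7 §7.2.2 p. 168] -/
theorem triBdrySucc_injOn : Set.InjOn (triBdrySucc D.verts) (triBdryDarts D.verts : Set (Site 2 × Site 2)) := by
  intro d₁ h₁ d₂ h₂ he
  rw [Finset.mem_coe] at h₁ h₂
  have hD := D.isTriDisc
  -- the common successor sits at some position `n`; take `n = #∂` if it is the base
  obtain ⟨n, hn, hdn⟩ := D.cycle _ (triBdrySucc_mem h₁)
  by_cases hn0 : n = 0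
  · subst hn0
    have hL : triBdrySucc D.verts d₁ = triBdryIter D.verts D.base #(triBdryDarts D.verts) := by rw [D.cycle_len, ← hdn, triBdryIter_zero]
    rw [hD.eq_iter_pred h₁ hD.card_pos le_rfl hL, hD.eq_iter_pred h₂ hD.card_pos le_rfl (he ▸ hL)]
  · have h1n : 1 ≤ n := Nat.one_le_iff_ne_zero.2 hn0
    rw [hD.eq_iter_pred h₁ h1n hn.le hdn.symm, hD.eq_iter_pred h₂ h1n hn.le (he ▸ hdn.symm)]

/-- **the predecessor dart of a mark is the boundary dart whose successor is the marked dart.** [cite: BollobasRiordan2006, Ch. 7 §7.2.2 p. 169 (marked at the second outside neighbour)] -/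
theorem predDart_eq_of_succ_eq (i : Fin k) {d : Site 2 × Site 2} (hd : d ∈ triBdryDarts D.verts) (hs : triBdrySucc D.verts d = D.markDart i) :
    MarkedLoops.predDart D i = d :=
  D.triBdrySucc_injOn (MarkedLoops.predDart_mem D i) hd ((MarkedLoops.succ_predDart D i).trans hs.symm)

end TriMarkedDomain

namespace MarkedLoops

open TriMarkedDomain

variable {k : ℕ} (D : TriMarkedDomain k)

/-- ★ **THE CORNER FACE OF A TURNING MARK**: if the `i`-th marked dart is `(g, g + e_{j+1})` and `g + e_j ∉ G` — the boundary walk reaches it by TURNING about `g` from `(g, g + e_j)` —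
then the corner face `y_i` is `leftFaceDir g j`, the face spanned by `g` and its two consecutive outside neighbours `g + e_j`, `g + e_{j+1}` (Khristoforov–Smirnov's disorder `u_i`).
[cite: BollobasRiordan2006, Ch. 7 §7.2.2 p. 169 (marked at the second outside neighbour); KhristoforovSmirnov2021, §1.2 (arXiv v1 p. 2: corner disorders)] -/
theorem yc_eq_leftFaceDir (i : Fin k) {g : Site 2} {j : Fin 6} (hmark : D.markDart i = (g, g + triDir (j + 1))) (hj : g + triDir j ∉ D.verts) :
    yc D i = leftFaceDir g j := by
  have hg : g ∈ D.verts := by have := markSite_mem D i; unfold TriMarkedDomain.markSite at this; rwa [hmark] at this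
  have hj1 : g + triDir (j + 1) ∉ D.verts := by have := markDart_snd_not_mem D i; rwa [hmark] at this
  have hpred : predDart D i = (g, g + triDir j) :=
    D.predDart_eq_of_succ_eq i (mem_triBdryDarts.2 ⟨hg, hj, triGraph_adj_add_triDir g j⟩) (by rw [triBdrySucc_turn j hj1, hmark])
  symm
  apply eq_yc D
  unfold IsCornerFace
  rw [RemovableAt.hexFaceVertices_leftFaceDir, TriMarkedDomain.markSite, hmark, hpred]
  simp only
  rw [Finset.pair_comm]

end MarkedLoops

namespace TriMarkedDomain

/-! ## §3 The boundary order under attaching / removing one hexagon -/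

section Positions

variable {k : ℕ} (D : TriMarkedDomain k)

/-- **positions from a rebased dart**: if the base of `D` is the `β`-th dart of a traversal from `e` (`β < #∂`) then the `n`-th dart from `e` (`n < #∂`) has position `n − β` if
`β ≤ n`, and `n + #∂ − β` otherwise. [cite: BollobasRiordan2006, Ch. 7 §7.2.2 p. 168 (the boundary is one cycle); lane plumbing] -/
theorem dpos_eq_of_base_eq_iter {e : Site 2 × Site 2} (he : e ∈ triBdryDarts D.verts) {β : ℕ} (hβ : β < #(triBdryDarts D.verts))
    (hb : D.base = triBdryIter D.verts e β) {n : ℕ} (hn : n < #(triBdryDarts D.verts)) :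
    D.dpos (triBdryIter D.verts e n) = if β ≤ n then n - β else n + #(triBdryDarts D.verts) - β := by
  have hE : IsTriDisc D.verts e := D.isTriDisc.rebase he
  split_ifs with hle
  · apply D.dpos_eq_of_iter_eq (by omega)
    rw [hb, ← triBdryIter_add, show β + (n - β) = n by omega]
  · apply D.dpos_eq_of_iter_eq (by omega)
    rw [hb, ← triBdryIter_add, show β + (n + #(triBdryDarts D.verts) - β) = n + #(triBdryDarts D.verts) by omega, hE.iter_add_card]

end Positions

section Attach

variable {k' k₁ : ℕ} {D' : TriMarkedDomain k'} {D₁ : TriMarkedDomain k₁} {h : Site 2} {a m : Fin 6}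
  (R : RemovableAt D'.verts h a m) (hV : D₁.verts = D'.verts.erase h) (hB : D₁.base = D'.base) (hbh : D'.base.1 ≠ h)
  (hbP : D'.base ≠ RemovableAt.dPlus h a m)
include R hV hB hbh hbP

omit hV hB hbh hbP in
/-- **a dart of `∂G'` with tail off `h` sits before the block** in the traversal from `dPlus`: at a position `< #∂G' − m`. [cite: BollobasRiordan2006, Ch. 7 §7.2.2 p. 168] -/
theorem exists_pos_lt_of_fst_ne {d : Site 2 × Site 2} (hd : d ∈ triBdryDarts D'.verts) (hdh : d.1 ≠ h) :
    ∃ n, n < #(triBdryDarts D'.verts) - m.val ∧ triBdryIter D'.verts (RemovableAt.dPlus h a m) n = d := by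
  obtain ⟨n, hn, rfl⟩ := (R.isTriDisc_dPlus D'.isTriDisc).cycle d hd
  refine ⟨n, ?_, rfl⟩
  by_contra hge
  push Not at hge
  -- positions `≥ #∂ - m` are block darts, with tail `h`
  obtain ⟨-, hit⟩ := R.iter_block D'.isTriDisc (#(triBdryDarts D'.verts) - 1 - n) (by omega)
  rw [show #(triBdryDarts D'.verts) - 1 - (#(triBdryDarts D'.verts) - 1 - n) = n by omega] at hit
  exact hdh (by rw [hit]; rfl)

omit hV hB hbh hbP in
/-- the base of `D'` sits at a position `β` with `1 ≤ β < #∂G' − m` from `dPlus`. [cite: BollobasRiordan2006, Ch. 7 §7.2.2 p. 168; lane plumbing] -/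
theorem exists_base_pos (hbh : D'.base.1 ≠ h) (hbP : D'.base ≠ RemovableAt.dPlus h a m) :
    ∃ β, 1 ≤ β ∧ β < #(triBdryDarts D'.verts) - m.val ∧ triBdryIter D'.verts (RemovableAt.dPlus h a m) β = D'.base := by
  obtain ⟨β, hβ, e⟩ := exists_pos_lt_of_fst_ne R D'.base_mem hbh
  refine ⟨β, ?_, hβ, e⟩
  by_contra h0
  have : β = 0 := by omega
  subst this
  exact hbP e.symm

omit hB hbh hbP in
/-- the new domain traversed from `dPlus` follows the old traversal before the block. [cite: BollobasRiordan2006, Ch. 7 §7.2.2 p. 168] -/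
theorem iter₁_eq_of_lt {n : ℕ} (hn : n < #(triBdryDarts D'.verts) - m.val) :
    triBdryIter D₁.verts (RemovableAt.dPlus h a m) n = triBdryIter D'.verts (RemovableAt.dPlus h a m) n := by
  have h5 := R.le_five
  rw [hV, (R.iter_erase_eq D'.isTriDisc).1 n (by omega), RemovableAt.newIter, if_pos (by omega)]

omit hB hbh hbP in
/-- the boundary lengths: `#∂(G' ∖ h) = #∂G' + 6 − 2m`. [cite: BollobasRiordan2006, Ch. 7 §7.2.2 p. 168; lane plumbing] -/
theorem card₁_eq : #(triBdryDarts D₁.verts) = #(triBdryDarts D'.verts) + 6 - 2 * m.val := by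
  rw [hV, R.card_triBdryDarts_erase]

omit hbh hbP in
/-- ★ **positions of a common dart in the two domains**: the `n`-th dart from `dPlus` (`n < #∂G' − m`) has position `n − β` in both if `β ≤ n`, and positions `n + #∂ − β`
(with the respective boundary lengths) otherwise, where `β` is the position of the common base. [cite: BollobasRiordan2006, Ch. 7 §7.2.2 p. 168 (the boundary is one cycle)] -/
theorem dpos_pair_of_lt {β : ℕ} (hβ : β < #(triBdryDarts D'.verts) - m.val) (hb : triBdryIter D'.verts (RemovableAt.dPlus h a m) β = D'.base)
    {n : ℕ} (hn : n < #(triBdryDarts D'.verts) - m.val) :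
    D'.dpos (triBdryIter D'.verts (RemovableAt.dPlus h a m) n) = (if β ≤ n then n - β else n + #(triBdryDarts D'.verts) - β) ∧
      D₁.dpos (triBdryIter D'.verts (RemovableAt.dPlus h a m) n) = (if β ≤ n then n - β else n + #(triBdryDarts D₁.verts) - β) := by
  have h5 := R.le_five
  have hL₁ := card₁_eq R hV
  refine ⟨D'.dpos_eq_of_base_eq_iter R.dPlus_mem (by omega) hb.symm (by omega), ?_⟩
  have hP1 : RemovableAt.dPlus h a m ∈ triBdryDarts D₁.verts := by rw [hV]; exact R.dPlus_mem_erase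
  rw [← iter₁_eq_of_lt R hV hn]
  exact D₁.dpos_eq_of_base_eq_iter hP1 (by omega) (by rw [hB, iter₁_eq_of_lt R hV hβ, hb]) (by omega)

/-- ★★ **COMMON DARTS COMPARE IDENTICALLY IN THE TWO DOMAINS**: for two darts of `∂G'` with tails off `h` (hence darts of `∂(G' ∖ h)` too), `dpos` in `D'` and in `D₁` order
them the same way. [cite: BollobasRiordan2006, Ch. 7 §7.2.2 p. 168 (the boundary cycle); KhristoforovSmirnov2021, §1.2 (arXiv v1 p. 2: marked points in cyclic order)] -/
theorem dpos_lt_dpos_iff_of_common {d d' : Site 2 × Site 2} (hd : d ∈ triBdryDarts D'.verts) (hdh : d.1 ≠ h) (hd' : d' ∈ triBdryDarts D'.verts)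
    (hdh' : d'.1 ≠ h) : D'.dpos d < D'.dpos d' ↔ D₁.dpos d < D₁.dpos d' := by
  have h5 := R.le_five
  have hL₁ := card₁_eq R hV
  obtain ⟨β, h1β, hβ, hb⟩ := exists_base_pos R hbh hbP
  obtain ⟨n, hn, rfl⟩ := exists_pos_lt_of_fst_ne R hd hdh
  obtain ⟨n', hn', rfl⟩ := exists_pos_lt_of_fst_ne R hd' hdh'
  obtain ⟨e1, e2⟩ := dpos_pair_of_lt R hV hB hβ hb hn
  obtain ⟨e1', e2'⟩ := dpos_pair_of_lt R hV hB hβ hb hn'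
  rw [e1, e2, e1', e2']
  split_ifs <;> omega

omit hV hB hbh hbP in
/-- a block dart `(h, h + e_{a+t})`, `t < m`, sits at position `#∂G' − m + t` from `dPlus`. [cite: BollobasRiordan2006, Ch. 7 §7.2.2 p. 168] -/
theorem iter_blk (t : Fin 6) (ht : t.val < m.val) :
    triBdryIter D'.verts (RemovableAt.dPlus h a m) (#(triBdryDarts D'.verts) - m.val + t.val) = RemovableAt.blk h a t := by
  obtain ⟨hs, hit⟩ := R.iter_block D'.isTriDisc (m.val - 1 - t.val) (by omega)
  obtain ⟨h2, -⟩ := R.iter_dMinus D'.isTriDisc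
  have e : (⟨m.val - 1 - (m.val - 1 - t.val), by omega⟩ : Fin 6) = t := Fin.ext (by simp; omega)
  rw [e, show #(triBdryDarts D'.verts) - 1 - (m.val - 1 - t.val) = #(triBdryDarts D'.verts) - m.val + t.val by omega] at hit
  exact hit

/-- ★★ **THE BLOCK AND `dPlus` OCCUPY THE SAME SLOT**: a common dart precedes the block dart `(h, h + e_{a+t})` in `D'` iff it precedes `dPlus` in `D₁`.
[cite: BollobasRiordan2006, Ch. 7 §7.2.2 p. 168 (the boundary cycle); KhristoforovSmirnov2021, §1.2 (arXiv v1 p. 2: marked points in cyclic order)] -/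
theorem dpos_lt_blk_iff {d : Site 2 × Site 2} (hd : d ∈ triBdryDarts D'.verts) (hdh : d.1 ≠ h) (t : Fin 6) (ht : t.val < m.val) :
    D'.dpos d < D'.dpos (RemovableAt.blk h a t) ↔ D₁.dpos d < D₁.dpos (RemovableAt.dPlus h a m) := by
  have h5 := R.le_five
  have h1 := R.one_le
  have hL₁ := card₁_eq R hV
  obtain ⟨hL2, -⟩ := R.iter_dMinus D'.isTriDisc
  obtain ⟨β, h1β, hβ, hb⟩ := exists_base_pos R hbh hbP
  obtain ⟨n, hn, rfl⟩ := exists_pos_lt_of_fst_ne R hd hdh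
  obtain ⟨e1, e2⟩ := dpos_pair_of_lt R hV hB hβ hb hn
  -- the block dart in `D'`
  have eb : D'.dpos (RemovableAt.blk h a t) = #(triBdryDarts D'.verts) - m.val + t.val - β := by
    rw [← iter_blk R t ht, D'.dpos_eq_of_base_eq_iter R.dPlus_mem (by omega) hb.symm (by omega), if_pos (by omega)]
  -- `dPlus` in `D₁`: position `0` from `dPlus`
  have eP : D₁.dpos (RemovableAt.dPlus h a m) = #(triBdryDarts D₁.verts) - β := by
    have := (dpos_pair_of_lt R hV hB hβ hb (n := 0) (by omega)).2
    rw [triBdryIter_zero, if_neg (by omega)] at this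
    rw [this]; omega
  rw [e1, e2, eb, eP]
  split_ifs <;> omega

omit R hB hbh hbP in
/-- a dart of `∂G'` with tail off `h` is a dart of `∂(G' ∖ h)`. [cite: BollobasRiordan2006, Ch. 7 §7.2.2 p. 168; lane plumbing] -/
theorem mem_bdry₁_of_common {d : Site 2 × Site 2} (hd : d ∈ triBdryDarts D'.verts) (hdh : d.1 ≠ h) : d ∈ triBdryDarts D₁.verts := by
  rw [hV]
  exact RemovableAt.mem_erase_of_mem hd hdh

end Attach

/-! ## §4 The marks of `ofDarts` are the increasing enumeration of the marked set -/

section Enumeration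

variable {j : ℕ} (D : TriMarkedDomain j) {k : ℕ} (hk : 0 < k) (S : Finset (Site 2 × Site 2)) (hcard : #S = k) (hS : ∀ d ∈ S, IsMarkable D.verts d)
  (hinj : Set.InjOn Prod.fst (S : Set (Site 2 × Site 2)))

/-- the position of the `i`-th mark of `ofDarts` is the `i`-th sorted position. [cite: BollobasRiordan2006, Ch. 7 §7.2.2 p. 169; lane plumbing] -/
theorem dpos_ofDarts_markDart (i : Fin k) :
    D.dpos ((D.ofDarts hk S hcard hS hinj).markDart i) = D.dartPos S (D.card_visitTimes_of_markable S hcard hS) i := by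
  rw [ofDarts_markDart]
  exact D.dpos_eq_of_iter_eq (D.dartPos_lt_card S (fun d hd => (hS d hd).mem) _ i) rfl

/-- ★★ **THE MARKS OF `ofDarts` ARE THE UNIQUE INCREASING ENUMERATION OF `S`**: any `f : Fin k → S` strictly increasing in position is `markDart`.
[cite: BollobasRiordan2006, Ch. 7 §7.2.2 p. 169 (marked sites «appearing in this order as ∂⁻G is traversed anticlockwise»)] -/
theorem ofDarts_markDart_eq_of_strictMono (f : Fin k → Site 2 × Site 2) (hf : ∀ i, f i ∈ S) (hmono : StrictMono fun i => D.dpos (f i)) (i : Fin k) :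
    (D.ofDarts hk S hcard hS hinj).markDart i = f i := by
  have hT := D.card_visitTimes_of_markable S hcard hS
  -- `dpos ∘ f` is the increasing enumeration of the visit times
  have hmem : ∀ i, D.dpos (f i) ∈ D.visitTimes S := fun i => Finset.mem_image.2 ⟨f i, hf i, rfl⟩
  have huniq : (fun i => D.dpos (f i)) = (D.visitTimes S).orderEmbOfFin hT := Finset.orderEmbOfFin_unique hT hmem hmono
  have hfi : D.dpos (f i) = D.dartPos S hT i := congrFun huniq i
  -- both darts are boundary darts with the same position
  have hfb : f i ∈ triBdryDarts D.verts := (hS _ (hf i)).mem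
  have hmb : (D.ofDarts hk S hcard hS hinj).markDart i ∈ triBdryDarts D.verts := (hS _ (D.ofDarts_markDart_mem hk S hcard hS hinj i)).mem
  rw [← D.iter_dpos hmb, ← D.iter_dpos hfb, dpos_ofDarts_markDart, hfi]

end Enumeration

section TwoDomains

variable {j j' : ℕ} {D : TriMarkedDomain j} {D' : TriMarkedDomain j'} {k : ℕ} (hk : 0 < k)
  {S : Finset (Site 2 × Site 2)} (hcard : #S = k) (hS : ∀ d ∈ S, IsMarkable D.verts d) (hinj : Set.InjOn Prod.fst (S : Set (Site 2 × Site 2)))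
  {S' : Finset (Site 2 × Site 2)} (hcard' : #S' = k) (hS' : ∀ d ∈ S', IsMarkable D'.verts d) (hinj' : Set.InjOn Prod.fst (S' : Set (Site 2 × Site 2)))

/-- ★★ **AN ORDER-PRESERVING BIJECTION OF MARKED SETS CARRIES MARKS TO MARKS, INDEX BY INDEX**: if `φ` maps `S` into `S'` and preserves the position order, then the `i`-th mark of
`D'.ofDarts S'` is `φ` of the `i`-th mark of `D.ofDarts S`. [cite: BollobasRiordan2006, Ch. 7 §7.2.2 p. 169; KhristoforovSmirnov2021, §1.2 (arXiv v1 p. 2: marked points in cyclic order)] -/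
theorem ofDarts_markDart_eq_of_orderIso (φ : Site 2 × Site 2 → Site 2 × Site 2) (hφ : ∀ d ∈ S, φ d ∈ S')
    (hord : ∀ d ∈ S, ∀ d' ∈ S, D.dpos d < D.dpos d' → D'.dpos (φ d) < D'.dpos (φ d')) (i : Fin k) :
    (D'.ofDarts hk S' hcard' hS' hinj').markDart i = φ ((D.ofDarts hk S hcard hS hinj).markDart i) := by
  refine D'.ofDarts_markDart_eq_of_strictMono hk S' hcard' hS' hinj' (fun i => φ ((D.ofDarts hk S hcard hS hinj).markDart i))
    (fun i => hφ _ (D.ofDarts_markDart_mem hk S hcard hS hinj i)) (fun a b hab => ?_) i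
  simp only
  refine hord _ (D.ofDarts_markDart_mem hk S hcard hS hinj a) _ (D.ofDarts_markDart_mem hk S hcard hS hinj b) ?_
  rw [D.dpos_ofDarts_markDart, D.dpos_ofDarts_markDart]
  exact D.dartPos_strictMono S _ hab

end TwoDomains

end TriMarkedDomain

end Literature.Probability.Percolation
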